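import Summits.CriticalPhenomena.SAWScalingLimit.Theses.SAWBrownianDomination
import Summits.CriticalPhenomena.SAWScalingLimit.Theorems.SAWTensorRGRestrictionOfLimitGenericRestriction

/-!
# Strategy census companion (crux-strategist s2, conversation dc88edd2): the BROWNIAN-DOMINATION transfer, typed

Crux `RestrictionOfLimit` (stmt-CriticalPhenomena-0773). The one sibling lever that neither the registered line `birth`
(compositions 1–5) nor the lead reports c1–c4 examine is the thesis of the route `SAWBrownianDomination` itself: at
criticality the SAW is dominated, polynomially, by the Brownian EXCURSION (LSW03: a one-sided restriction measure of
exponent `α` avoids a hull `A` with probability `Φ'_A(0)^α`, and `1 - p^{5/8} ≤ 1 - p` — the SLE_{8/3} HITTING probabilities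
are dominated by the excursion's with `C = θ = 1`, for every hull, IN THE CONTINUUM). Transplanted to the lattice and
specialised to the single event the crux needs — "the SAW of the outer domain `E` EXITS the subdomain `D'`" — it reads
`HullExitDomination` below (implied by `SAWBrownianDomination.UniformDomination`, stmt-11295, with `η = nil`, `S = ` the
sites beyond `D'`, up to the edge/vertex phrasing of "exit"). Together with a classical random-walk statement
`ExcursionExitSmall` (an `h`-transformed simple random walk in `E` from `a_δ` to `b_δ` rarely enters a thin collar
`E ∖ D'` glued along `∂D' ∩ D` away from the marks, uniformly in the mesh: gambler's ruin + discrete Harnack/Beurling), it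
would give the HULL half of S3, `NoAvoidanceLossHull`, hence (landed `restriction_pair_of_noAvoidanceLoss`, p151626) the
restriction identity at every hull pair: `restriction_hullPair_of_noAvoidanceLossHull` below (proved).

Why this is recorded in the census and NOT registered as a line: in the regime where it is used (`E ↓ D'`, collar width
`ρ → 0`) `HullExitDomination` IS a uniform-in-`δ`, uniform-in-the-domain boundary-repulsion bound for the critical ℤ² SAW
(`P_{E,δ}[walk enters the ρ-collar of a boundary arc] ≤ C ρ^{θ'}`), i.e. the same untooled a-priori estimate as
`stub_nullTouchHull`, now in comparison form; its parent stmt-11295 carries a recorded refuter witness as typed (interior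
ring, corridor widths) and no named technique proves any hull-robust form on ℤ² (no parafermionic observable:
`Literature.Barriers.CriticalPhenomena.NienhuisWeightsExcludeVertexSAW`; no Markov driver:
`Literature.Barriers.CriticalPhenomena.SAWNotKineticallyGrown`). Non-hull (pinched) pairs are not dominated at all near the
pinched mark (the excursion enters every collar at its own starting point). See STRATEGY-CENSUS.md, Addendum (dc88edd2); this file is published as the crux workfile `DominationTransfer.lean`.

No new axioms; nothing here is proposed to the tree's Theorems (it closes nothing); `DominationTransfer` is a `Prop`, not a claim.
-/

noncomputable section

open MeasureTheory Filter Topology Set Metric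
open Literature.Probability.RandomPlanarGeometry Literature.Probability.LatticeModels
open scoped ENNReal NNReal

namespace Summit.CriticalPhenomena.SAWScalingLimit.Cruxes.RestrictionOfLimit.CensusDomination

/-- Simple-random-walk path mass `Σ_{ω ∈ A} 4^{-|ω|}` over nearest-neighbour walks of `Ω_δ` from `z` to `w`
(the excursion weight of `SAWBrownianDomination.UniformDomination`, named). [folklore] -/
def rwMass (Ω : Set ℂ) (δ : ℝ) (z w : Site 2) (A : Set ((discreteDomainGraph Ω δ).Walk z w)) : ℝ≥0∞ :=
  ∑' ω : (discreteDomainGraph Ω δ).Walk z w, A.indicator (fun ω' => (4 : ℝ≥0∞)⁻¹ ^ ω'.length) ω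

/-- Random-walk paths of `Ω_δ` that EXIT `D'_δ`: some edge is not an edge of the graph of `D'`. [folklore] -/
def exitsRW (D' Ω : Set ℂ) (δ : ℝ) (z w : Site 2) : Set ((discreteDomainGraph Ω δ).Walk z w) :=
  {ω | ∃ e ∈ ω.edges, e ∉ (discreteDomainGraph D' δ).edgeSet}

/-- SAWs of `Ω_δ` that EXIT `D'_δ` (complement of the S1/S3 event "walk of `D'_δ`"). [folklore] -/
def exitsSAW (D' Ω : Set ℂ) (δ : ℝ) (z w : Site 2) : Set (SAW.DomainSAW Ω δ z w) :=
  {γ | ∃ e ∈ γ.walk.edges, e ∉ (discreteDomainGraph D' δ).edgeSet}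

/-- **HullExitDomination** (the transplanted lever, cross-multiplied in `ℝ≥0∞`): there are universal `C, θ > 0` with
`P^{SAW}_{E,δ}(z → w)[exit D'] · (RW mass of all z→w paths of E_δ)^θ ≤ C · (RW mass of the z→w paths of E_δ that exit D')^θ`,
i.e. `P^{SAW}[exit D'] ≤ C · (P^{RW-excursion}[exit D'])^θ`, for every same-marked Dobrushin pair `D' ⊆ E`, mesh and endpoints.
Specialisation of stmt-11295 (`UniformDomination`, forbidden set empty, target = beyond `D'`). CONJECTURAL; in the collar
regime it is uniform boundary repulsion of the critical SAW. [cite: LawlerSchrammWerner2003Restriction, §8] -/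
def HullExitDomination : Prop :=
  ∃ (C : NNReal) (θ : ℝ), 0 < θ ∧
    ∀ (E D' : DobrushinDomain) (δ : ℝ) (z w : Site 2), 0 < δ →
      D'.carrier ⊆ E.carrier → D'.pt 0 = E.pt 0 → D'.pt 1 = E.pt 1 →
      SAW.law E.carrier δ z w (exitsSAW D'.carrier E.carrier δ z w) *
          rwMass E.carrier δ z w Set.univ ^ θ ≤
        (C : ℝ≥0∞) * rwMass E.carrier δ z w (exitsRW D'.carrier E.carrier δ z w) ^ θ

/-- **ExcursionExitSmall** (classical discrete potential theory, not in Mathlib): for a hull pair `D' ⊆ D` and any endpoint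
approximation of `D'`, thin separated outer collars `E ⊇ D'` inside `D` are entered by the random-walk excursion
`a_δ → b_δ` of `E_δ` with limsup-probability as small as desired. [cite: LawlerSchrammWerner2004LERW, §2.2–2.4] -/
def ExcursionExitSmall : Prop :=
  ∀ (D D' : DobrushinDomain), D.IsHullSubdomain D' →
    ∀ (a b : ℝ → Site 2), SAW.IsEndpointApprox D' a b →
      ∀ ε : ℝ≥0∞, 0 < ε →
        ∃ E : DobrushinDomain, D'.carrier ⊆ E.carrier ∧ E.carrier ⊆ D.carrier ∧
          E.pt 0 = D.pt 0 ∧ E.pt 1 = D.pt 1 ∧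
          closure D'.carrier ∩ closure (D.carrier \ E.carrier) = ∅ ∧
          limsup (fun δ : ℝ => rwMass E.carrier δ (a δ) (b δ) (exitsRW D'.carrier E.carrier δ (a δ) (b δ)) /
              rwMass E.carrier δ (a δ) (b δ) Set.univ) (𝓝[>] (0 : ℝ)) ≤ ε

/-- **NoAvoidanceLossHull** — the hull half of S3: no avoidance mass is lost in the limit, for every hull pair and
every endpoint approximation of the inner domain (the hypothesis `hN` of `restriction_pair_of_noAvoidanceLoss`). [folklore] -/
def NoAvoidanceLossHull : Prop :=
  ∀ P : ChordalFamily, SAW.IsScalingLimitFamily P →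
    ∀ (D D' : DobrushinDomain), D.IsHullSubdomain D' →
      ∀ (a b : ℝ → Site 2), SAW.IsEndpointApprox D' a b →
        P D (CurveClass.rangeSubset (closure D'.carrier)) ≤
          liminf (fun δ : ℝ => SAW.law D.carrier δ (a δ) (b δ)
            {γ : SAW.DomainSAW D.carrier δ (a δ) (b δ) |
              ∀ e ∈ γ.walk.edges, e ∈ (discreteDomainGraph D'.carrier δ).edgeSet}) (𝓝[>] (0 : ℝ))

/-- The transfer a line would have to prove (stated, NOT claimed): lattice restriction `P_D|_{E-walks} = (Z_E/Z_D)·P_E` (S1),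
portmanteau on the open event `{range ⊆ (cl(D∖E))ᶜ}` ⊇ `{range ⊆ cl D'}` (separation), and the two hypotheses bound the exit
mass by `C ε^θ` for every `ε`. [folklore] -/
def DominationTransfer : Prop :=
  HullExitDomination → ExcursionExitSmall → NoAvoidanceLossHull

/-- Sanity (proved): `NoAvoidanceLossHull` gives LSW's restriction identity at every hull pair, by the landed localised
squeeze `restriction_pair_of_noAvoidanceLoss` (p151626) and `SAW.exists_isEndpointApprox`. [folklore] -/
theorem restriction_hullPair_of_noAvoidanceLossHull (h : NoAvoidanceLossHull) {P : ChordalFamily}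
    (hP : SAW.IsScalingLimitFamily P) {D D' : DobrushinDomain} (hH : D.IsHullSubdomain D')
    {T : Set (CurveClass ℂ)} (hT : MeasurableSet T) :
    P D' T * P D (CurveClass.rangeSubset (closure D'.carrier)) =
      P D (T ∩ CurveClass.rangeSubset (closure D'.carrier)) := by
  obtain ⟨a, b, hab⟩ := SAW.exists_isEndpointApprox D'
  exact Theorems.RestrictionOfLimit.Birth.restriction_pair_of_noAvoidanceLoss hP hH.1 hH.2.1 hH.2.2.1 hab
    (h P hP D D' hH a b hab) hT

end Summit.CriticalPhenomena.SAWScalingLimit.Cruxes.RestrictionOfLimit.CensusDomination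

end
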